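import Literature.NumberTheory.Sieve.IPZeroCubes
import HarnessLib

/-!
# Green–Tao 2010, Example 2: cubes — complexity `≤ d − 2` in every dimension, and prime cubes

Topic `Literature/NumberTheory/Sieve`. Source: B. Green, T. Tao, *Linear equations in primes*,
Ann. of Math. 171 (2010), §1 (arXiv:math/0606088 p. 5):

> **Example 2 (Cubes).** Let `d ≥ 2` and `t := 2^{d−1}`. Then the system
> `Ψ(n₁, …, n_d) := (n₁ + ∑_{j∈A} n_j)_{A ⊆ {2,…,d}}` (which counts `(d−1)`-dimensional cubes
> whose vertices are all prime) has a very large value of `t`, but has complexity at most `d − 2`.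
> For instance, if one considers the form `n₁`, then one can cover the other `t − 1` forms by
> `d − 1` classes, with the `i`-th class consisting of those forms which involve `n_{i+1}`, then
> `n₁` is not in the affine span of any of these classes because the `i`-th class always assigns
> the same coefficient to both `n₁` and `n_{i+1}`. The other forms can be treated similarly after
> "reflecting" the cube appropriately.

Kernel form, with `d = m + 1` (`m` = dimension of the cube, variables `n₀` = base vertex and
`n₁, …, n_m` = edges): `cubeSystem m = (n₀ + ∑_{j∈A} n_j)_{A ⊆ [m]}`, `t = cubeCount m = 2^m`
forms (`cubeCount_eq`). **Example 2** is `complexity_cubeSystem_le : complexity (cubeSystem m) ≤ m − 1`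
with Green–Tao's cover made uniform ("reflecting"): for the form `ψ_B` the `m` classes are
`{ψ_{B'} : j ∉ B'}` for `j ∈ B` (witness `e_j`) and `{ψ_{B'} : B' ⊋ B, j ∈ B'}` for `j ∉ B`
(witness `e₀ − e_j` — "the same coefficient to both `n₁` and `n_{i+1}`"). Consequence through
Cor. 1.9 (`GreenTao2010_corollary19_of_mainTheoremAtComplexity`): from the Main Theorem at
complexity `m − 1` there are infinitely many `m`-dimensional cubes `n₀ + {0,1}^m · (n₁,…,n_m)`,
`0 < n₀ < n₁ < ⋯ < n_m`, all of whose `2^m` vertices are prime (`GreenTao2010_example2_primeCubes`);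
`m = 2` (prime parallelograms `p, p+a, p+b, p+a+b`) UNCONDITIONALLY, `m = 3` (prime
`3`-cubes, `8` vertices) from the named facts `GITwo`, `MNTwo`. (The tree's
`PrimeParallelograms` treats the explicit `m = 2` system `parallelogramSystem` with its von
Mangoldt asymptotic; the present file is the all-`d` complexity statement of Example 2.)

## References

* [GreenTao2010] B. Green, T. Tao, *Linear equations in primes*, Ann. of Math. (2) 171 (2010),
  §1 Example 2, Def. 1.5, Cor. 1.9.
-/

noncomputable section

open Finset

namespace Literature.NumberTheory.Sieve

variable {m : ℕ}

/-! ### The cube system -/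

/-- `t = #{A ⊆ [m]}`, the number of vertices of an `m`-cube. [cite: GreenTao2010, Example 2] -/
def cubeCount (m : ℕ) : ℕ := Fintype.card (Finset (Fin m))

/-- `t = 2^m` (`= 2^{d−1}`). [cite: GreenTao2010, Example 2] -/
theorem cubeCount_eq (m : ℕ) : cubeCount m = 2 ^ m := by
  rw [cubeCount, Fintype.card_finset, Fintype.card_fin]

/-- A fixed enumeration of the subsets of `[m]`. [cite: GreenTao2010, Example 2] -/
def cubeSet (k : Fin (cubeCount m)) : Finset (Fin m) := (Fintype.equivFin (Finset (Fin m))).symm k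

/-- The enumeration is injective. [cite: GreenTao2010, Example 2] -/
theorem cubeSet_injective : Function.Injective (cubeSet (m := m)) :=
  (Fintype.equivFin _).symm.injective

/-- Every subset is enumerated. [cite: GreenTao2010, Example 2] -/
theorem exists_cubeSet_eq (A : Finset (Fin m)) : ∃ k : Fin (cubeCount m), cubeSet k = A :=
  ⟨Fintype.equivFin _ A, by simp [cubeSet]⟩

/-- There is at least one form. [cite: GreenTao2010, Example 2] -/
theorem one_le_cubeCount (m : ℕ) : 1 ≤ cubeCount m :=
  Fintype.card_pos_iff.mpr ⟨∅⟩

/-- The vertex form `n₀ + ∑_{j∈A} n_j` on `ℤ^{m+1}` (coordinates `0` = base, `j.succ` = edge `j`).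
[cite: GreenTao2010, Example 2] -/
def vertexForm (A : Finset (Fin m)) : AffLinForm (m + 1) :=
  ⟨fun l => Fin.cases 1 (fun j => if j ∈ A then 1 else 0) l, 0⟩

/-- **The cube system** `(n₀ + ∑_{j∈A} n_j)_{A ⊆ [m]}` in `d = m + 1` variables.
[cite: GreenTao2010, Example 2] -/
def cubeSystem (m : ℕ) : Fin (cubeCount m) → AffLinForm (m + 1) := fun k => vertexForm (cubeSet k)

/-- `ψ̇_A(f) = f₀ + ∑_{j∈A} f_j`. [cite: GreenTao2010, Example 2] -/
@[simp] theorem linearPart_vertexForm (A : Finset (Fin m)) (f : Fin (m + 1) → ℤ) :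
    (vertexForm A).linearPart f = f 0 + ∑ j ∈ A, f j.succ := by
  classical
  simp [vertexForm, AffLinForm.linearPart, Fin.sum_univ_succ, ite_mul, Finset.sum_ite_mem,
    Finset.univ_inter]

/-- The forms are homogeneous. [cite: GreenTao2010, Example 2] -/
@[simp] theorem vertexForm_const (A : Finset (Fin m)) : (vertexForm A).const = 0 := rfl

/-- `ψ_A(n) = n₀ + ∑_{j∈A} n_j`. [cite: GreenTao2010, Example 2] -/
@[simp] theorem eval_vertexForm (A : Finset (Fin m)) (n : Fin (m + 1) → ℤ) :
    (vertexForm A).eval n = n 0 + ∑ j ∈ A, n j.succ := by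
  rw [AffLinForm.eval_eq_linearPart_add_const, linearPart_vertexForm, vertexForm_const, add_zero]

/-- The `k`-th form evaluated. [cite: GreenTao2010, Example 2] -/
theorem eval_cubeSystem (k : Fin (cubeCount m)) (n : Fin (m + 1) → ℤ) :
    (cubeSystem m k).eval n = n 0 + ∑ j ∈ cubeSet k, n j.succ :=
  eval_vertexForm _ _

/-- The `k`-th linear part. [cite: GreenTao2010, Example 2] -/
theorem linearPart_cubeSystem (k : Fin (cubeCount m)) (f : Fin (m + 1) → ℤ) :
    (cubeSystem m k).linearPart f = f 0 + ∑ j ∈ cubeSet k, f j.succ :=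
  linearPart_vertexForm _ _

/-! ### Example 2: complexity at most `d − 2 = m − 1` -/

/-- **Green–Tao 2010, Example 2: the cube system in `d = m + 1` variables has complexity at most
`d − 2 = m − 1`** (`m ≥ 1`). Cover of the forms `ψ_{B'}`, `B' ≠ B`, by `m` classes indexed by the
edges `j`: `{ψ_{B'} : j ∉ B'}` if `j ∈ B` (witness `e_j`), `{ψ_{B'} : B' ⊋ B, j ∈ B'}` if `j ∉ B`
(witness `e₀ − e_j`: such forms give `n₀` and `n_j` the same coefficient, `ψ_B` does not).
[cite: GreenTao2010, Example 2 and Def. 1.5] -/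
theorem complexity_cubeSystem_le (hm : 1 ≤ m) : complexity (cubeSystem m) ≤ (m - 1 : ℕ) := by
  classical
  obtain ⟨e, rfl⟩ : ∃ e, m = e + 1 := ⟨m - 1, by omega⟩
  rw [Nat.add_sub_cancel]
  refine complexity_le_coe_iff.mpr fun k => ?_
  set B := cubeSet k with hB
  refine ⟨fun j : Fin (e + 1) => if j ∈ B then univ.filter (fun l => l ≠ k ∧ j ∉ cubeSet l)
      else univ.filter (fun l => B ⊆ cubeSet l ∧ j ∈ cubeSet l), fun l hl => ?_, fun j => ?_⟩
  · -- cover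
    have hne : cubeSet l ≠ B := fun h => hl (cubeSet_injective (h.trans hB))
    by_cases hsub : B ⊆ cubeSet l
    · obtain ⟨j, hjT, hjB⟩ := Finset.exists_of_ssubset (lt_of_le_of_ne hsub (Ne.symm hne))
      refine ⟨j, ?_⟩
      dsimp only
      rw [if_neg hjB]
      exact Finset.mem_filter.mpr ⟨Finset.mem_univ _, hsub, hjT⟩
    · obtain ⟨j, hjB, hjT⟩ := Finset.not_subset.mp hsub
      refine ⟨j, ?_⟩
      dsimp only
      rw [if_pos hjB]
      exact Finset.mem_filter.mpr ⟨Finset.mem_univ _, hl, hjT⟩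
  · -- avoid
    dsimp only
    by_cases hjB : j ∈ B
    · rw [if_pos hjB]
      refine not_memAffLinSpan_of_witness (fun l => if l = j.succ then 1 else 0)
        (fun l hl => ?_) ?_
      · have hl' := (Finset.mem_filter.mp hl).2.2
        rw [linearPart_cubeSystem, if_neg (Fin.succ_ne_zero j).symm, zero_add]
        simp only [Fin.succ_inj]
        rw [Finset.sum_ite_eq' (cubeSet l) j, if_neg hl']
      · rw [linearPart_cubeSystem, ← hB, if_neg (Fin.succ_ne_zero j).symm, zero_add]
        simp only [Fin.succ_inj]
        rw [Finset.sum_ite_eq' B j, if_pos hjB]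
        exact one_ne_zero
    · rw [if_neg hjB]
      refine not_memAffLinSpan_of_witness
        (fun l => (if l = 0 then 1 else 0) - (if l = j.succ then 1 else 0)) (fun l hl => ?_) ?_
      · obtain ⟨-, hjT⟩ := (Finset.mem_filter.mp hl).2
        rw [linearPart_cubeSystem, if_pos rfl, if_neg (Fin.succ_ne_zero j).symm, Finset.sum_sub_distrib]
        simp only [Fin.succ_ne_zero, if_false, Finset.sum_const_zero, Fin.succ_inj, zero_sub]
        rw [Finset.sum_ite_eq' (cubeSet l) j, if_pos hjT]
        ring
      · rw [linearPart_cubeSystem, ← hB, if_pos rfl, if_neg (Fin.succ_ne_zero j).symm,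
          Finset.sum_sub_distrib]
        simp only [Fin.succ_ne_zero, if_false, Finset.sum_const_zero, Fin.succ_inj, zero_sub]
        rw [Finset.sum_ite_eq' B j, if_neg hjB]
        norm_num

/-- In Green–Tao's indexing (`d ≥ 2` variables, `(d−1)`-cubes): complexity `≤ d − 2`.
[cite: GreenTao2010, Example 2] -/
theorem complexity_cubeSystem_le' {d : ℕ} (hd : 2 ≤ d) :
    complexity (cubeSystem (d - 1)) ≤ (d - 2 : ℕ) := by
  have := complexity_cubeSystem_le (m := d - 1) (by omega)
  rwa [show d - 1 - 1 = d - 2 by omega] at this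

/-! ### Prime cubes from the Main Theorem at complexity `m − 1` -/

/-- No local obstruction: at `n = e₀` every vertex form equals `1`. [cite: GreenTao2010, Cor. 1.9] -/
theorem cubeSystem_locallySolvable (m p : ℕ) (hp : p.Prime) :
    ∃ n : Fin (m + 1) → ℤ, ∀ k, ¬ ((p : ℤ) ∣ (cubeSystem m k).eval n) := by
  refine ⟨fun l => if l = 0 then 1 else 0, fun k h => ?_⟩
  rw [eval_cubeSystem] at h
  simp only [Fin.succ_ne_zero, if_false, Finset.sum_const_zero, add_zero] at h
  have : p ∣ 1 := by exact_mod_cast Int.natAbs_dvd_natAbs.mpr h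
  exact hp.ne_one (Nat.dvd_one.mp this)

/-- **Green–Tao 2010, Example 2 (prime cubes), from the Main Theorem at complexity `m − 1`.**
Assume the Main Theorem for systems of complexity `≤ m − 1` (`m ≥ 1`). Then there are infinitely
many `(n₀, n₁, …, n_m)` with `0 < n₀ < n₁ < ⋯ < n_m` such that all `2^m` vertices
`n₀ + ∑_{j∈A} n_j` (`A ⊆ [m]`) of the `m`-dimensional cube with base `n₀` and edges `n₁, …, n_m`
are prime. [cite: GreenTao2010, Example 2 and Cor. 1.9] -/
theorem GreenTao2010_example2_primeCubes (hm : 1 ≤ m)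
    (h : GreenTao2010_mainTheoremAtComplexity (m - 1)) :
    {n : Fin (m + 1) → ℤ | (∀ i, 0 < n i) ∧ (∀ i j, i < j → n i < n j) ∧
      ∀ A : Finset (Fin m), (n 0 + ∑ j ∈ A, n j.succ).toNat.Prime}.Infinite := by
  have hpos : ∃ n : Fin (m + 1) → ℤ, realPoint n ∈ increasingCone (m + 1) ∧
      ∀ k, 0 < (cubeSystem m k).linearPart n := by
    refine ⟨fun i => (i : ℤ) + 1, ⟨fun i => ?_, fun i j hij => ?_⟩, fun k => ?_⟩
    · simp only [realPoint]; positivity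
    · simp only [realPoint]
      have : (i : ℝ) < j := by exact_mod_cast hij
      push_cast; linarith
    · rw [linearPart_cubeSystem]
      exact add_pos_of_pos_of_nonneg (by norm_num) (Finset.sum_nonneg fun j _ => by positivity)
  have key := GreenTao2010_corollary19_of_mainTheoremAtComplexity h (by omega) (one_le_cubeCount m)
    (cubeSystem m) (complexity_cubeSystem_le hm) (isOpen_increasingCone (m + 1))
    (convex_increasingCone (m + 1)) (fun r hr x hx => smul_mem_increasingCone hr hx)
    (cubeSystem_locallySolvable m) hpos
  refine key.mono fun n hn => ?_
  obtain ⟨⟨h1, h2⟩, h3⟩ := hn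
  refine ⟨fun i => ?_, fun i j hij => ?_, fun A => ?_⟩
  · have := h1 i; simp only [realPoint] at this; exact_mod_cast this
  · have := h2 i j hij; simp only [realPoint] at this; exact_mod_cast this
  · obtain ⟨k, hk⟩ := exists_cubeSet_eq A
    have := h3 k
    rwa [eval_cubeSystem, hk] at this

/-- **Prime parallelograms (`m = 2`, unconditional — complexity `1`):** infinitely many
`0 < p < a < b` with `p, p + a, p + b, p + a + b` all prime. [cite: GreenTao2010, Example 2 (d = 3)] -/
theorem GreenTao2010_example2_parallelograms :
    {n : Fin 3 → ℤ | 0 < n 0 ∧ n 0 < n 1 ∧ n 1 < n 2 ∧ (n 0).toNat.Prime ∧ (n 0 + n 1).toNat.Prime ∧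
      (n 0 + n 2).toNat.Prime ∧ (n 0 + n 1 + n 2).toNat.Prime}.Infinite := by
  refine (GreenTao2010_example2_primeCubes (m := 2) (by norm_num)
    GreenTao2010_mainTheoremAtComplexity_one).mono fun n hn => ?_
  obtain ⟨h1, h2, h3⟩ := hn
  refine ⟨h1 0, h2 0 1 (by decide), h2 1 2 (by decide), ?_, ?_, ?_, ?_⟩
  · simpa using h3 ∅
  · simpa using h3 {0}
  · simpa using h3 {1}
  · have := h3 {0, 1}
    rw [Finset.sum_pair (show (0 : Fin 2) ≠ 1 by decide)] at this
    simpa [add_assoc] using this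

/-- **Prime `3`-cubes (`m = 3`), from `GI(2)` and `MN(2)`:** assuming the named facts `GITwo`,
`MNTwo`, there are infinitely many `0 < p < a < b < c` such that the eight vertices
`p, p+a, p+b, p+c, p+a+b, p+a+c, p+b+c, p+a+b+c` are all prime. [cite: GreenTao2010, Example 2 (d = 4)] -/
theorem GreenTao2010_example2_threeCubes_of_GI_of_MN (hGI : GreenTaoLevelTwo.GITwo)
    (hMN : GreenTaoLevelTwo.MNTwo) :
    {n : Fin 4 → ℤ | 0 < n 0 ∧ n 0 < n 1 ∧ n 1 < n 2 ∧ n 2 < n 3 ∧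
      (n 0).toNat.Prime ∧ (n 0 + n 1).toNat.Prime ∧ (n 0 + n 2).toNat.Prime ∧
      (n 0 + n 3).toNat.Prime ∧ (n 0 + n 1 + n 2).toNat.Prime ∧ (n 0 + n 1 + n 3).toNat.Prime ∧
      (n 0 + n 2 + n 3).toNat.Prime ∧ (n 0 + n 1 + n 2 + n 3).toNat.Prime}.Infinite := by
  refine (GreenTao2010_example2_primeCubes (m := 3) (by norm_num)
    (GreenTao2010_mainTheoremAtComplexity_two_of_GI_of_MN hGI hMN)).mono fun n hn => ?_
  obtain ⟨h1, h2, h3⟩ := hn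
  refine ⟨h1 0, h2 0 1 (by decide), h2 1 2 (by decide), h2 2 3 (by decide),
    ?_, ?_, ?_, ?_, ?_, ?_, ?_, ?_⟩
  · simpa using h3 ∅
  · simpa using h3 {0}
  · simpa using h3 {1}
  · simpa using h3 {2}
  · have := h3 {0, 1}
    rw [Finset.sum_pair (show (0 : Fin 3) ≠ 1 by decide)] at this
    simpa [add_assoc] using this
  · have := h3 {0, 2}
    rw [Finset.sum_pair (show (0 : Fin 3) ≠ 2 by decide)] at this
    simpa [add_assoc] using this
  · have := h3 {1, 2}
    rw [Finset.sum_pair (show (1 : Fin 3) ≠ 2 by decide)] at this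
    simpa [add_assoc] using this
  · have := h3 {0, 1, 2}
    simpa [Finset.sum_insert, add_assoc] using this

end Literature.NumberTheory.Sieve

end
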